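import Summits.Ventures.PackingBounds.Configurations.Dim22Card891Data

/-!
# The 891-point sharp configuration on `S²¹` as an explicit section of the Leech lattice: `A(22, arccos 1/4) = 891` and the ground-state energy — kernel checks, part B

Framing: lottery ticket; floor = certified bounds/negative ranges. Histogram chunks `8`–`18` of
the configuration of `Configurations/Dim22Card891Data` (see there and `Configurations/Dim22Card891`).
-/

namespace Summit.Ventures.PackingBounds.Config.Dim22Card891

open Summit.Ventures.PackingBounds.Config

set_option maxRecDepth 100000 in
/-- Kernel check (distance distribution), rows of chunk `8` against the whole configuration. -/
theorem hist_8 : histOK vecs891 table891 vecs891c8 = true := by decide +kernel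

set_option maxRecDepth 100000 in
/-- Kernel check (distance distribution), rows of chunk `9` against the whole configuration. -/
theorem hist_9 : histOK vecs891 table891 vecs891c9 = true := by decide +kernel

set_option maxRecDepth 100000 in
/-- Kernel check (distance distribution), rows of chunk `10` against the whole configuration. -/
theorem hist_10 : histOK vecs891 table891 vecs891c10 = true := by decide +kernel

set_option maxRecDepth 100000 in
/-- Kernel check (distance distribution), rows of chunk `11` against the whole configuration. -/
theorem hist_11 : histOK vecs891 table891 vecs891c11 = true := by decide +kernel

set_option maxRecDepth 100000 in
/-- Kernel check (distance distribution), rows of chunk `12` against the whole configuration. -/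
theorem hist_12 : histOK vecs891 table891 vecs891c12 = true := by decide +kernel

set_option maxRecDepth 100000 in
/-- Kernel check (distance distribution), rows of chunk `13` against the whole configuration. -/
theorem hist_13 : histOK vecs891 table891 vecs891c13 = true := by decide +kernel

set_option maxRecDepth 100000 in
/-- Kernel check (distance distribution), rows of chunk `14` against the whole configuration. -/
theorem hist_14 : histOK vecs891 table891 vecs891c14 = true := by decide +kernel

set_option maxRecDepth 100000 in
/-- Kernel check (distance distribution), rows of chunk `15` against the whole configuration. -/
theorem hist_15 : histOK vecs891 table891 vecs891c15 = true := by decide +kernel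

set_option maxRecDepth 100000 in
/-- Kernel check (distance distribution), rows of chunk `16` against the whole configuration. -/
theorem hist_16 : histOK vecs891 table891 vecs891c16 = true := by decide +kernel

set_option maxRecDepth 100000 in
/-- Kernel check (distance distribution), rows of chunk `17` against the whole configuration. -/
theorem hist_17 : histOK vecs891 table891 vecs891c17 = true := by decide +kernel

set_option maxRecDepth 100000 in
/-- Kernel check (distance distribution), rows of chunk `18` against the whole configuration. -/
theorem hist_18 : histOK vecs891 table891 vecs891c18 = true := by decide +kernel

end Summit.Ventures.PackingBounds.Config.Dim22Card891
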